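import Mathlib.Analysis.Calculus.SmoothSeries
import Mathlib.Analysis.SpecificLimits.Normed
import Literature.NumberTheory.LFunctions.LogIntegral
import HarnessLib

/-!
# Discharges of named facts of `LogIntegral.lean`: `Li_k x ∼ x / (log x)^k`,
# `li' x = 1 / log x`, the series for `li`, and `Li_k' x = (log x)⁻ᵏ`

D-0014 keeps `Literature/` sorry-free by stating cited results as named facts `def X : Prop`.
This sibling file of `Literature.NumberTheory.LFunctions.LogIntegral` proves the named fact
`Literature.NumberTheory.LFunctions.isEquivalent_offsetLogIntegralPow` — `Li_k x = ∫₂ˣ dt/(log t)^k ∼ x/(log x)^k` as `x → ∞`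
for every `k : ℕ` — as `theorem isEquivalent_offsetLogIntegralPow_holds` (users holding
`(h : isEquivalent_offsetLogIntegralPow)`, e.g. the `Li_k` form of Bateman–Horn in
`Literature.NumberTheory.Sieve.AletheiaZomleferFukshanskyGarcia2020`, are fed `_holds`).

Hardy–Littlewood (*Partitio Numerorum* III, Acta Math. 44 (1923) 1–70) use the equivalence
`Li_m(x) = ∫₂ˣ du/(log u)^m ∼ x/(log x)^m` tacitly: (5.631), p. 56, states the prime `m`-tuple
asymptotic with main term `x/(log x)^m`, and Theorem X 1, (5.663)–(5.664), p. 61, "restates"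
it with `Li_m(x)`; for `m = 2` they remark (§5.32, p. 44) that (5.322) "is naturally equivalent
to" (5.311) because `∫₂ⁿ dx/(log x)² = n (log n)⁻² (1 + 2!/log n + 3!/(log n)² + ⋯)`.

The elementary proof below: one integration by parts,
`Li_k x = x (log x)⁻ᵏ − 2 (log 2)⁻ᵏ + k Li_{k+1} x` (`offsetLogIntegralPow_integration_by_parts`),
and the tail estimate `Li_{k+1} x ≤ Li_{k+1} T + (log T)⁻¹ Li_k x` for `2 ≤ T ≤ x`
(`offsetLogIntegralPow_succ_le`), which gives `Li_{k+1} = o(Li_k)`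
(`isLittleO_offsetLogIntegralPow_succ`) because `Li_k x ≥ (x − 2)(log x)⁻ᵏ → ∞`
(`tendsto_offsetLogIntegralPow_atTop`). Hence `x (log x)⁻ᵏ − Li_k x = O(1) + k Li_{k+1} x
= o(Li_k x)`.

## `hasDerivAt_logIntegral` (section `HasDerivAtLogIntegral`)

`Literature.NumberTheory.LFunctions.logIntegral` is *defined* by the series of Abramowitz–Stegun 5.1.10 composed with `log`
(5.1.3: `li x = Ei (log x)`, `x > 1`; 5.1.10: `Ei u = γ + ln u + ∑_{n ≥ 1} uⁿ/(n n!)`, `u > 0`;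
both p. 228), so `li' x = 1/log x` is obtained by differentiating 5.1.10 termwise:
`(d/du) ∑_{n ≥ 1} uⁿ/(n n!) = ∑_{n ≥ 1} uⁿ⁻¹/n! = (eᵘ − 1)/u` (`hasDerivAt_tsum_pow_succ_div`,
justified by Mathlib's `hasDerivAt_tsum_of_isPreconnected` with the majorant `Rⁿ/n!` on
`(−R, R)`), hence `Ei' u = 1/u + (eᵘ − 1)/u = eᵘ/u` (consistent with 5.1.26 for `n = 1`,
5.1.24 and 5.1.7), and the chain rule with `u = log x`, `eᵘ = x` gives
`li' x = (x / log x) · x⁻¹ = 1 / log x` (`hasDerivAt_logIntegral_holds`).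

## The series for `li` (`hasSum_logIntegral_series`)

Section `HasSumLogIntegralSeries` below proves the named fact `Literature.NumberTheory.LFunctions.hasSum_logIntegral_series`:
for `x > 1`, Ramanujan's (Nielsen's) series `∑_{n ≥ 0} (log x)^(n+1) / ((n+1) · (n+1)!)` has sum
`li x − γ − log log x`. Since `Literature.NumberTheory.LFunctions.logIntegral` is *defined* by this series
(Abramowitz–Stegun 5.1.3 `li x = Ei (ln x)`, `x > 1`, and 5.1.10
`Ei x = γ + ln x + ∑_{n ≥ 1} xⁿ / (n · n!)`, `x > 0`; the same pair of formulas is printed in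
Oldham–Myland–Spanier, *An Atlas of Functions*, 37:0:2 `li(x) = Ei(ln x)` (p. 281) and 37:0:1
with 37:6:1 `Ein(x) = −∑_{j ≥ 1} (−x)^j / (j! j)` (pp. 281–282)), the content of the fact is the
(absolute) convergence of the series for every real `x`, `summable_logIntegralSeriesTerm`,
obtained by comparison with the exponential series `∑ |log x|^(n+1) / (n+1)!`
(Mathlib `Real.summable_pow_div_factorial`).

## The derivative of `Li_k` (`hasDerivAt_offsetLogIntegralPow`)

Section `HasDerivAtOffsetLogIntegralPow` below proves the named fact
`Literature.NumberTheory.LFunctions.hasDerivAt_offsetLogIntegralPow` — `Li_k` has derivative `(log x)⁻ᵏ` at every `x > 1` — as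
`theorem hasDerivAt_offsetLogIntegralPow_holds`. Abramowitz–Stegun, ch. 5 (W. Gautschi,
W. F. Cahill), §5.1, p. 228, eq. 5.1.3 *defines* `li x = ∫₀ˣ dt / ln t = Ei (ln x)` (`x > 1`);
`Li_k x = ∫₂ˣ dt/(log t)^k` is the offset `k`-th-power analogue and the derivative is the first
fundamental theorem of calculus (`intervalIntegral.integral_hasDerivAt_right`) applied to the
defining integral, the integrand being continuous on the open set `(1, ∞) ∋ 2, x`.

## References

* G. H. Hardy, J. E. Littlewood, *Some problems of 'Partitio numerorum'; III: On the expression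
  of a number as a sum of primes*, Acta Math. 44 (1923), 1–70, §5.32 (p. 44), (5.631) (p. 56),
  Theorem X 1 (5.663)–(5.664) (p. 61). [cite: HardyLittlewoodPN3]
* M. Abramowitz, I. A. Stegun (eds.), *Handbook of Mathematical Functions with Formulas, Graphs,
  and Mathematical Tables*, NBS Applied Mathematics Series 55, 1964 (10th printing 1972),
  ch. 5 (W. Gautschi, W. F. Cahill), §5.1, formulas 5.1.3, 5.1.7, 5.1.10, 5.1.24, 5.1.26,
  pp. 228–230. [cite: AbramowitzStegun1964]
* K. B. Oldham, J. Myland, J. Spanier, *An Atlas of Functions*, 2nd ed., Springer 2009, ch. 37,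
  37:0:1, 37:0:2 (p. 281), 37:6:1 (p. 282). [cite: OldhamMylandSpanier2009]
-/

noncomputable section

open Real Filter Asymptotics Set
open scoped Topology

namespace Literature.NumberTheory.LFunctions

section IsEquivalentOffsetLogIntegralPow

/-- Points of `uIcc a b` exceed `1` when `a, b > 1`. [folklore] -/
private theorem one_lt_of_mem_uIcc {a b t : ℝ} (ha : 1 < a) (hb : 1 < b)
    (ht : t ∈ uIcc a b) : 1 < t := by
  rcases Set.mem_uIcc.1 ht with h | h <;> linarith [h.1]

/-- The integrand `(log t)⁻¹ ^ k` of `Li_k` is continuous on `(1, ∞)`. [folklore] -/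
theorem continuousOn_inv_log_pow (k : ℕ) :
    ContinuousOn (fun t : ℝ => (Real.log t)⁻¹ ^ k) (Ioi 1) := by
  refine ((Real.continuousOn_log.mono ?_).inv₀ ?_).pow k
  · intro t ht
    simp only [mem_compl_iff, mem_singleton_iff]
    exact (zero_lt_one.trans ht).ne'
  · intro t ht
    exact (Real.log_pos ht).ne'

/-- The integrand `(log t)⁻¹ ^ k` of `Li_k` is interval integrable between any two points
of `(1, ∞)`. [folklore] -/
theorem intervalIntegrable_inv_log_pow (k : ℕ) {a b : ℝ} (ha : 1 < a) (hb : 1 < b) :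
    IntervalIntegrable (fun t : ℝ => (Real.log t)⁻¹ ^ k) MeasureTheory.volume a b :=
  ((continuousOn_inv_log_pow k).mono fun _ ht => one_lt_of_mem_uIcc ha hb ht).intervalIntegrable

/-- `d/dt (t (log t)⁻ᵏ) = (log t)⁻ᵏ − k (log t)⁻ᵏ⁻¹` for `t > 1`. [folklore] -/
theorem hasDerivAt_mul_inv_log_pow (k : ℕ) {t : ℝ} (ht : 1 < t) :
    HasDerivAt (fun u : ℝ => u * (Real.log u)⁻¹ ^ k)
      ((Real.log t)⁻¹ ^ k - k * (Real.log t)⁻¹ ^ (k + 1)) t := by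
  have ht0 : t ≠ 0 := (zero_lt_one.trans ht).ne'
  have hlog : Real.log t ≠ 0 := (Real.log_pos ht).ne'
  have h1 : HasDerivAt (fun u : ℝ => (Real.log u)⁻¹) (-(t⁻¹) / (Real.log t) ^ 2) t :=
    (Real.hasDerivAt_log ht0).fun_inv hlog
  have h2 : HasDerivAt (fun u : ℝ => (Real.log u)⁻¹ ^ k)
      ((k : ℝ) * (Real.log t)⁻¹ ^ (k - 1) * (-(t⁻¹) / (Real.log t) ^ 2)) t := h1.fun_pow k
  have h3 : HasDerivAt (fun u : ℝ => u * (Real.log u)⁻¹ ^ k)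
      (1 * (Real.log t)⁻¹ ^ k
        + t * ((k : ℝ) * (Real.log t)⁻¹ ^ (k - 1) * (-(t⁻¹) / (Real.log t) ^ 2))) t :=
    (hasDerivAt_id' t).fun_mul h2
  refine h3.congr_deriv ?_
  cases k with
  | zero => simp
  | succ n =>
    rw [Nat.add_sub_cancel]
    push_cast
    simp only [inv_pow]
    field_simp
    ring

/-- Integration by parts for `Li_k` (`x > 1`):
`Li_k x = x (log x)⁻ᵏ − 2 (log 2)⁻ᵏ + k · Li_{k+1} x`
(the first step of the expansion in Hardy–Littlewood, PN III, §5.32, p. 44).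
[cite: HardyLittlewoodPN3, §5.32 p. 44] -/
theorem offsetLogIntegralPow_integration_by_parts (k : ℕ) {x : ℝ} (hx : 1 < x) :
    offsetLogIntegralPow k x
      = x * (Real.log x)⁻¹ ^ k - 2 * (Real.log 2)⁻¹ ^ k + k * offsetLogIntegralPow (k + 1) x := by
  have h2 : (1 : ℝ) < 2 := one_lt_two
  have hderiv : ∀ t ∈ uIcc (2 : ℝ) x, HasDerivAt (fun u : ℝ => u * (Real.log u)⁻¹ ^ k)
      ((Real.log t)⁻¹ ^ k - k * (Real.log t)⁻¹ ^ (k + 1)) t :=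
    fun t ht => hasDerivAt_mul_inv_log_pow k (one_lt_of_mem_uIcc h2 hx ht)
  have hik := intervalIntegrable_inv_log_pow k h2 hx
  have hik1 := (intervalIntegrable_inv_log_pow (k + 1) h2 hx).const_mul (k : ℝ)
  have := intervalIntegral.integral_eq_sub_of_hasDerivAt hderiv (hik.sub hik1)
  rw [intervalIntegral.integral_sub hik hik1, intervalIntegral.integral_const_mul] at this
  simp only [offsetLogIntegralPow]
  linarith

/-- `Li_k x ≥ 0` for `x ≥ 2`. [folklore] -/
theorem offsetLogIntegralPow_nonneg (k : ℕ) {x : ℝ} (hx : 2 ≤ x) :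
    0 ≤ offsetLogIntegralPow k x :=
  intervalIntegral.integral_nonneg hx fun t ht =>
    pow_nonneg (inv_nonneg.2 (Real.log_nonneg (by linarith [ht.1]))) k

/-- The tail estimate `Li_{k+1} x ≤ Li_{k+1} T + (log T)⁻¹ · Li_k x` for `2 ≤ T ≤ x`
(split `∫₂ˣ` at `T` and use `(log t)⁻¹ ≤ (log T)⁻¹` on `[T, x]`). [folklore] -/
theorem offsetLogIntegralPow_succ_le (k : ℕ) {T x : ℝ} (hT : 2 ≤ T) (hTx : T ≤ x) :
    offsetLogIntegralPow (k + 1) x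
      ≤ offsetLogIntegralPow (k + 1) T + (Real.log T)⁻¹ * offsetLogIntegralPow k x := by
  have h1T : (1 : ℝ) < T := by linarith
  have h1x : (1 : ℝ) < x := by linarith
  have hlogT : 0 < Real.log T := Real.log_pos h1T
  have hsplit : offsetLogIntegralPow (k + 1) x
      = offsetLogIntegralPow (k + 1) T + ∫ t in T..x, (Real.log t)⁻¹ ^ (k + 1) := by
    unfold offsetLogIntegralPow
    rw [intervalIntegral.integral_add_adjacent_intervals
      (intervalIntegrable_inv_log_pow (k + 1) one_lt_two h1T)
      (intervalIntegrable_inv_log_pow (k + 1) h1T h1x)]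
  have htail : ∫ t in T..x, (Real.log t)⁻¹ ^ (k + 1)
      ≤ ∫ t in T..x, (Real.log T)⁻¹ * (Real.log t)⁻¹ ^ k := by
    refine intervalIntegral.integral_mono_on hTx
      (intervalIntegrable_inv_log_pow (k + 1) h1T h1x)
      ((intervalIntegrable_inv_log_pow k h1T h1x).const_mul _) fun t ht => ?_
    have hlogt : Real.log T ≤ Real.log t := Real.log_le_log (by linarith) ht.1
    have h0 : 0 ≤ (Real.log t)⁻¹ := inv_nonneg.2 (hlogT.le.trans hlogt)
    rw [pow_succ']
    exact mul_le_mul_of_nonneg_right (inv_anti₀ hlogT hlogt) (pow_nonneg h0 k)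
  have hk : ∫ t in T..x, (Real.log T)⁻¹ * (Real.log t)⁻¹ ^ k
      = (Real.log T)⁻¹ * (offsetLogIntegralPow k x - offsetLogIntegralPow k T) := by
    rw [intervalIntegral.integral_const_mul]
    congr 1
    unfold offsetLogIntegralPow
    rw [← intervalIntegral.integral_add_adjacent_intervals
      (intervalIntegrable_inv_log_pow k one_lt_two h1T)
      (intervalIntegrable_inv_log_pow k h1T h1x)]
    ring
  have hkT : 0 ≤ offsetLogIntegralPow k T := offsetLogIntegralPow_nonneg k hT
  have hinv : 0 ≤ (Real.log T)⁻¹ := inv_nonneg.2 hlogT.le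
  have hprod : 0 ≤ (Real.log T)⁻¹ * offsetLogIntegralPow k T := mul_nonneg hinv hkT
  rw [hk] at htail
  linarith [hsplit, htail, hprod, mul_sub (Real.log T)⁻¹ (offsetLogIntegralPow k x)
    (offsetLogIntegralPow k T)]

/-- The trivial lower bound `(x − 2)(log x)⁻ᵏ ≤ Li_k x` for `x ≥ 2`
(the integrand is at least `(log x)⁻ᵏ` on `[2, x]`). [folklore] -/
theorem sub_mul_inv_log_pow_le_offsetLogIntegralPow (k : ℕ) {x : ℝ} (hx : 2 ≤ x) :
    (x - 2) * (Real.log x)⁻¹ ^ k ≤ offsetLogIntegralPow k x := by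
  have h1x : (1 : ℝ) < x := by linarith
  have hconst : ∫ _ in (2 : ℝ)..x, (Real.log x)⁻¹ ^ k = (x - 2) * (Real.log x)⁻¹ ^ k := by
    rw [intervalIntegral.integral_const, smul_eq_mul]
  rw [← hconst]
  refine intervalIntegral.integral_mono_on hx intervalIntegrable_const
    (intervalIntegrable_inv_log_pow k one_lt_two h1x) fun t ht => ?_
  have hlogt : 0 < Real.log t := Real.log_pos (by linarith [ht.1])
  exact pow_le_pow_left₀ (inv_nonneg.2 (Real.log_nonneg h1x.le))
    (inv_anti₀ hlogt (Real.log_le_log (by linarith [ht.1]) ht.2)) k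

/-- `x (log x)⁻ᵏ → ∞` as `x → ∞` (from Mathlib's `(log x)^k = o(x)`). [folklore] -/
theorem tendsto_self_mul_inv_log_pow_atTop (k : ℕ) :
    Tendsto (fun x : ℝ => x * (Real.log x)⁻¹ ^ k) atTop atTop := by
  have h0 : Tendsto (fun x : ℝ => Real.log x ^ k / x) atTop (𝓝 0) := by
    simpa using (Real.isLittleO_pow_log_id_atTop (n := k)).tendsto_div_nhds_zero
  have hpos : ∀ᶠ x : ℝ in atTop, Real.log x ^ k / x ∈ Ioi 0 := by
    filter_upwards [eventually_gt_atTop 1] with x hx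
    exact div_pos (pow_pos (Real.log_pos hx) k) (by linarith)
  have h1 : Tendsto (fun x : ℝ => Real.log x ^ k / x) atTop (𝓝[>] 0) :=
    tendsto_nhdsWithin_iff.2 ⟨h0, hpos⟩
  refine h1.inv_tendsto_nhdsGT_zero.congr' ?_
  filter_upwards [eventually_gt_atTop 0] with x hx
  show (Real.log x ^ k / x)⁻¹ = x * (Real.log x)⁻¹ ^ k
  rw [inv_div, div_eq_mul_inv, inv_pow]

/-- `Li_k x → ∞` as `x → ∞`. [folklore] -/
theorem tendsto_offsetLogIntegralPow_atTop (k : ℕ) :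
    Tendsto (offsetLogIntegralPow k) atTop atTop := by
  have h : Tendsto (fun x : ℝ => 2⁻¹ * (x * (Real.log x)⁻¹ ^ k)) atTop atTop :=
    (tendsto_self_mul_inv_log_pow_atTop k).const_mul_atTop (by norm_num)
  refine tendsto_atTop_mono' atTop ?_ h
  filter_upwards [eventually_ge_atTop 4] with x hx
  have h0 : 0 ≤ (Real.log x)⁻¹ ^ k :=
    pow_nonneg (inv_nonneg.2 (Real.log_nonneg (by linarith))) k
  calc 2⁻¹ * (x * (Real.log x)⁻¹ ^ k) ≤ (x - 2) * (Real.log x)⁻¹ ^ k := by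
        nlinarith [mul_nonneg (sub_nonneg.2 hx) h0]
    _ ≤ offsetLogIntegralPow k x := sub_mul_inv_log_pow_le_offsetLogIntegralPow k (by linarith)

/-- `Li_{k+1} = o(Li_k)` at `+∞`. [folklore] -/
theorem isLittleO_offsetLogIntegralPow_succ (k : ℕ) :
    offsetLogIntegralPow (k + 1) =o[atTop] offsetLogIntegralPow k := by
  refine Asymptotics.isLittleO_iff.2 fun c hc => ?_
  set T : ℝ := max 2 (Real.exp (2 / c)) with hT_def
  have hT2 : 2 ≤ T := le_max_left _ _
  have hlogT : 2 / c ≤ Real.log T := by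
    calc 2 / c = Real.log (Real.exp (2 / c)) := (Real.log_exp _).symm
      _ ≤ Real.log T := Real.log_le_log (Real.exp_pos _) (le_max_right _ _)
  have hlogT_pos : 0 < Real.log T := lt_of_lt_of_le (div_pos two_pos hc) hlogT
  have hinvT : (Real.log T)⁻¹ ≤ c / 2 := by
    have := inv_anti₀ (div_pos two_pos hc) hlogT
    rwa [inv_div] at this
  have hF := tendsto_offsetLogIntegralPow_atTop k
  filter_upwards [eventually_ge_atTop T,
    (hF.const_mul_atTop (half_pos hc)).eventually_ge_atTop (offsetLogIntegralPow (k + 1) T)]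
    with x hxT h1
  have hx2 : 2 ≤ x := hT2.trans hxT
  have hk0 : 0 ≤ offsetLogIntegralPow k x := offsetLogIntegralPow_nonneg k hx2
  have hk1 : 0 ≤ offsetLogIntegralPow (k + 1) x := offsetLogIntegralPow_nonneg (k + 1) hx2
  rw [Real.norm_of_nonneg hk1, Real.norm_of_nonneg hk0]
  have hle := offsetLogIntegralPow_succ_le k hT2 hxT
  have h2 : (Real.log T)⁻¹ * offsetLogIntegralPow k x ≤ (c / 2) * offsetLogIntegralPow k x :=
    mul_le_mul_of_nonneg_right hinvT hk0
  linarith [hle, h1, h2]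

/-- **Discharge of `isEquivalent_offsetLogIntegralPow`**: `Li_k x ∼ x / (log x)^k` as `x → ∞`,
for every `k : ℕ` — the equivalence between the two main-term forms (5.631), p. 56, and
Theorem X 1 (5.663)–(5.664), p. 61, of Hardy–Littlewood, *Partitio Numerorum* III
(for `k = 2`: §5.32, p. 44, "(5.322) is naturally equivalent to (5.311)").
[cite: HardyLittlewoodPN3, §5.66 Thm X 1 (5.663)–(5.664) with (5.631); §5.32 p. 44] -/
theorem isEquivalent_offsetLogIntegralPow_holds : isEquivalent_offsetLogIntegralPow := by
  intro k
  refine (IsLittleO.isEquivalent ?_ :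
    (fun x => x / Real.log x ^ k) ~[atTop] offsetLogIntegralPow k).symm
  have hF := tendsto_offsetLogIntegralPow_atTop k
  have h1 : (fun _ : ℝ => 2 * (Real.log 2)⁻¹ ^ k) =o[atTop] offsetLogIntegralPow k :=
    Asymptotics.isLittleO_const_left.2 (Or.inr (tendsto_norm_atTop_atTop.comp hF))
  have h2 : (fun x => (k : ℝ) * offsetLogIntegralPow (k + 1) x) =o[atTop]
      offsetLogIntegralPow k :=
    (isLittleO_offsetLogIntegralPow_succ k).const_mul_left _
  refine (h1.sub h2).congr' ?_ EventuallyEq.rfl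
  filter_upwards [eventually_gt_atTop 1] with x hx
  have := offsetLogIntegralPow_integration_by_parts k hx
  simp only [Pi.sub_apply, div_eq_mul_inv]
  rw [← inv_pow]
  linarith

end IsEquivalentOffsetLogIntegralPow

section HasDerivAtLogIntegral

open scoped Nat

/-! ### `li' x = 1 / log x` (discharge of `hasDerivAt_logIntegral`) -/

/-- Each term `u ↦ u^(n+1)/((n+1)(n+1)!)` of the series in Abramowitz–Stegun 5.1.10 (re-indexed
from `n = 0`, as in `logIntegralSeriesTerm`) has derivative `u^n/(n+1)!`. [folklore] -/
theorem hasDerivAt_pow_succ_div (n : ℕ) (u : ℝ) :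
    HasDerivAt (fun v : ℝ => v ^ (n + 1) / ((n + 1 : ℝ) * ((n + 1)! : ℝ)))
      (u ^ n / ((n + 1)! : ℝ)) u := by
  refine ((hasDerivAt_pow (n + 1) u).div_const ((n + 1 : ℝ) * ((n + 1)! : ℝ))).congr_deriv
    ?_
  rw [Nat.cast_add, Nat.cast_one, Nat.add_sub_cancel]
  have h1 : (n + 1 : ℝ) ≠ 0 := by positivity
  have h2 : ((n + 1)! : ℝ) ≠ 0 := by positivity
  field_simp

/-- `∑_{n ≥ 0} uⁿ/(n+1)! = (eᵘ − 1)/u` for `u ≠ 0` (the exponential series with its constant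
term removed, divided by `u`). [folklore] -/
theorem hasSum_pow_div_factorial_succ {u : ℝ} (hu : u ≠ 0) :
    HasSum (fun n : ℕ => u ^ n / ((n + 1)! : ℝ)) ((Real.exp u - 1) / u) := by
  have h : HasSum (fun n : ℕ => u ^ n / (n ! : ℝ)) (Real.exp u) := by
    rw [Real.exp_eq_exp_ℝ]
    exact NormedSpace.expSeries_div_hasSum_exp u
  have h1 := (hasSum_nat_add_iff' 1).mpr h
  simp only [Finset.sum_range_one, pow_zero, Nat.factorial_zero, Nat.cast_one, div_one] at h1
  have h2 : (fun n : ℕ => u ^ (n + 1) / ((n + 1)! : ℝ) / u) = fun n => u ^ n / ((n + 1)! : ℝ) := by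
    funext n
    rw [pow_succ]
    field_simp
  simpa only [h2] using h1.div_const u

/-- Termwise differentiation of the series part of `li`: for `u ≠ 0`,
`(d/du) ∑_{n ≥ 0} u^(n+1)/((n+1)(n+1)!) = ∑_{n ≥ 0} uⁿ/(n+1)! = (eᵘ − 1)/u`
(Weierstrass `M`-test with majorant `Rⁿ/n!` on `(−R, R)`, `R = |u| + 1`, via Mathlib's
`hasDerivAt_tsum_of_isPreconnected`). [folklore] -/
theorem hasDerivAt_tsum_pow_succ_div {u : ℝ} (hu : u ≠ 0) :
    HasDerivAt (fun v : ℝ => ∑' n : ℕ, v ^ (n + 1) / ((n + 1 : ℝ) * ((n + 1)! : ℝ)))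
      ((Real.exp u - 1) / u) u := by
  set R : ℝ := |u| + 1 with hR
  have hR0 : 0 < R := by positivity
  have huR : u ∈ Ioo (-R) R := by
    have := abs_lt.mp (lt_add_one |u|)
    exact ⟨this.1, this.2⟩
  have key := hasDerivAt_tsum_of_isPreconnected (𝕜 := ℝ) (F := ℝ)
    (g := fun (n : ℕ) (v : ℝ) => v ^ (n + 1) / ((n + 1 : ℝ) * ((n + 1)! : ℝ)))
    (g' := fun (n : ℕ) (v : ℝ) => v ^ n / ((n + 1)! : ℝ))
    (u := fun n : ℕ => R ^ n / (n ! : ℝ)) (t := Ioo (-R) R) (y₀ := 0) (y := u)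
    (Real.summable_pow_div_factorial R) isOpen_Ioo (convex_Ioo (-R) R).isPreconnected
    (fun n v _ => hasDerivAt_pow_succ_div n v) ?_ ?_ ?_ huR
  · rwa [(hasSum_pow_div_factorial_succ hu).tsum_eq] at key
  · intro n v hv
    rw [Real.norm_eq_abs, abs_div, abs_pow, Nat.abs_cast]
    have hv' : |v| ≤ R := (abs_lt.mpr ⟨hv.1, hv.2⟩).le
    calc |v| ^ n / ((n + 1)! : ℝ) ≤ R ^ n / ((n + 1)! : ℝ) := by gcongr
      _ ≤ R ^ n / (n ! : ℝ) := by
        apply div_le_div_of_nonneg_left (by positivity) (by positivity)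
        exact_mod_cast Nat.factorial_le (Nat.le_succ n)
  · simp [hR0]
  · simp

/-- **Discharge of `hasDerivAt_logIntegral`.** `li' x = 1/log x` for `x > 1`: by
Abramowitz–Stegun 5.1.3, `li x = ∫₀ˣ dt/ln t = Ei (ln x)` (`x > 1`), with `Ei` given by the
series 5.1.10, `Ei u = γ + ln u + ∑_{n ≥ 1} uⁿ/(n n!)` (`u > 0`), both p. 228 — which is how
`logIntegral` is defined. Differentiating 5.1.10 termwise (`hasDerivAt_tsum_pow_succ_div`) gives
`Ei' u = 1/u + (eᵘ − 1)/u = eᵘ/u` (consistent with 5.1.26, `n = 1`, 5.1.24 and 5.1.7, pp. 228–230),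
and the chain rule with `u = log x`, `eᵘ = x` gives `li' x = (x/log x) · x⁻¹ = 1/log x`.
[cite: AbramowitzStegun1964, 5.1.3 and 5.1.10, p. 228] -/
theorem hasDerivAt_logIntegral_holds : hasDerivAt_logIntegral := by
  intro x hx
  have hx0 : x ≠ 0 := (zero_lt_one.trans hx).ne'
  have hlog : Real.log x ≠ 0 := (Real.log_pos hx).ne'
  have h1 : HasDerivAt (fun y : ℝ => Real.log (Real.log y)) ((Real.log x)⁻¹ * x⁻¹) x :=
    (Real.hasDerivAt_log hlog).comp x (Real.hasDerivAt_log hx0)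
  have h2 : HasDerivAt (fun y : ℝ => ∑' n : ℕ, logIntegralSeriesTerm y n)
      ((Real.exp (Real.log x) - 1) / Real.log x * x⁻¹) x :=
    (hasDerivAt_tsum_pow_succ_div hlog).comp x (Real.hasDerivAt_log hx0)
  have h3 := (h1.const_add Real.eulerMascheroniConstant).add h2
  rw [Real.exp_log (zero_lt_one.trans hx)] at h3
  refine h3.congr_deriv ?_
  field_simp
  ring

end HasDerivAtLogIntegral

section HasSumLogIntegralSeries

open scoped Nat

/-- Summability of Ramanujan's (Nielsen's) series for `li`: for every real `x` the series
`∑_{n ≥ 0} (log x)^(n+1) / ((n+1) · (n+1)!)` converges (absolutely), by comparison with the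
exponential series `∑ |log x|^(n+1) / (n+1)!` — the power series 5.1.10 of `Ei` in
Abramowitz–Stegun converges for every argument; equivalently Oldham–Myland–Spanier 37:6:1 with
37:0:1–37:0:2 (pp. 281–282).
[cite: AbramowitzStegun1964, 5.1.10; OldhamMylandSpanier2009 37:6:1, 37:0:1–37:0:2 pp. 281–282] -/
theorem summable_logIntegralSeriesTerm (x : ℝ) : Summable (logIntegralSeriesTerm x) := by
  -- the shifted exponential series `∑ (log x)^(n+1) / (n+1)!` is summable
  have hexp : Summable (fun n : ℕ => Real.log x ^ (n + 1) / ((n + 1)! : ℝ)) := by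
    have h := (Real.summable_pow_div_factorial (Real.log x)).comp_injective Nat.succ_injective
    simpa [Function.comp_def, Nat.succ_eq_add_one] using h
  refine Summable.of_norm_bounded hexp.abs (fun n => ?_)
  have hfac : (0 : ℝ) < ((n + 1)! : ℝ) := by positivity
  have hn : (1 : ℝ) ≤ (n + 1 : ℝ) := by
    have : (0 : ℝ) ≤ (n : ℝ) := n.cast_nonneg
    linarith
  rw [Real.norm_eq_abs, logIntegralSeriesTerm, abs_div, abs_div,
    abs_of_pos (mul_pos (by positivity) hfac), abs_of_pos hfac]
  refine div_le_div_of_nonneg_left (abs_nonneg _) hfac ?_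
  calc ((n + 1)! : ℝ) = 1 * ((n + 1)! : ℝ) := (one_mul _).symm
    _ ≤ (n + 1 : ℝ) * ((n + 1)! : ℝ) := mul_le_mul_of_nonneg_right hn hfac.le

/-- **Discharge of `hasSum_logIntegral_series`**: for `x > 1` Ramanujan's series has sum
`li x − γ − log log x`. With `li` *defined* by the series (Abramowitz–Stegun 5.1.3
`li x = Ei (ln x)`, `x > 1`, and 5.1.10 `Ei x = γ + ln x + ∑_{n ≥ 1} xⁿ / (n · n!)`, `x > 0`),
the content is exactly the convergence of the series, `summable_logIntegralSeriesTerm`.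
[cite: AbramowitzStegun1964, 5.1.10 with 5.1.3] -/
theorem hasSum_logIntegral_series_holds : hasSum_logIntegral_series := by
  intro x _hx
  have h : logIntegral x - Real.eulerMascheroniConstant - Real.log (Real.log x)
      = ∑' n, logIntegralSeriesTerm x n := by
    unfold logIntegral
    ring
  rw [h]
  exact (summable_logIntegralSeriesTerm x).hasSum

end HasSumLogIntegralSeries

section HasDerivAtOffsetLogIntegralPow

/-- **Discharge of `hasDerivAt_offsetLogIntegralPow`**: `Li_k = ∫₂^· dt/(log t)^k` has derivative
`(log x)⁻¹ ^ k` at every `x > 1`, for every `k : ℕ`. The integrand `t ↦ (log t)⁻¹ ^ k` is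
continuous on the open set `(1, ∞)` (`continuousOn_inv_log_pow`), which contains `x` and the
interval between `2` and `x` (`intervalIntegrable_inv_log_pow`), so the first fundamental theorem
of calculus (`intervalIntegral.integral_hasDerivAt_right`) applies. Source: Abramowitz–Stegun,
ch. 5, §5.1, p. 228, eq. 5.1.3, `li x = ∫₀ˣ dt / ln t = Ei (ln x)` (`x > 1`), of which `Li_k` is
the offset `k`-th-power analogue; the derivative is the fundamental theorem of calculus applied
to the defining integral. [cite: AbramowitzStegun1964, 5.1.3 (fundamental theorem of calculus)] -/
theorem hasDerivAt_offsetLogIntegralPow_holds : hasDerivAt_offsetLogIntegralPow := by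
  intro k x hx
  show HasDerivAt (fun u => ∫ t in (2 : ℝ)..u, (Real.log t)⁻¹ ^ k) ((Real.log x)⁻¹ ^ k) x
  exact intervalIntegral.integral_hasDerivAt_right (intervalIntegrable_inv_log_pow k one_lt_two hx)
    ((continuousOn_inv_log_pow k).stronglyMeasurableAtFilter isOpen_Ioi x hx)
    ((continuousOn_inv_log_pow k).continuousAt (Ioi_mem_nhds hx))

/-- Pointwise form of `hasDerivAt_offsetLogIntegralPow_holds`: `deriv Li_k x = (log x)⁻¹ ^ k`
for `x > 1`. [cite: AbramowitzStegun1964, 5.1.3 (fundamental theorem of calculus)] -/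
theorem deriv_offsetLogIntegralPow (k : ℕ) {x : ℝ} (hx : 1 < x) :
    deriv (offsetLogIntegralPow k) x = (Real.log x)⁻¹ ^ k :=
  (hasDerivAt_offsetLogIntegralPow_holds k hx).deriv

/-- `Li_k` is differentiable on `(1, ∞)`.
[cite: AbramowitzStegun1964, 5.1.3 (fundamental theorem of calculus)] -/
theorem differentiableOn_offsetLogIntegralPow (k : ℕ) :
    DifferentiableOn ℝ (offsetLogIntegralPow k) (Ioi 1) := fun _ hx =>
  (hasDerivAt_offsetLogIntegralPow_holds k hx).differentiableAt.differentiableWithinAt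

end HasDerivAtOffsetLogIntegralPow

end Literature.NumberTheory.LFunctions
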